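import Summits.AtomisticToContinuum.HydrodynamicLimit.Theorems.OneFlightGossipEngineCollisionActivityTailsPlaqueSplitDilute
import Summits.AtomisticToContinuum.HydrodynamicLimit.Theorems.OneFlightGossipEngineCollisionActivityTailsEntropyTransfer
import HarnessLib

/-!
# `CollisionActivityTails` (stmt-AtomisticToContinuum-13734), line `plaque-thinning-count-ld`, stub 3': entropy transfer with the dense-phase guard

Helper file (`--supports stmt-AtomisticToContinuum-13734`): the guarded twin `stub_entropyTransferDilute : EquilibriumUntaggedActivityLMGF' →
UntaggedActivityTails'` (statements of `…Theorems.CollisionActivityTailsPlaqueSplit`, dilute sequel) of the LANDED stub 3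
`…Theorems.CollisionActivityTailsEntropyTransfer.stub_entropyTransfer` (p130202). The proof is that file's, verbatim, with the guard `y σ³ ≤ 1`
passed from the conclusion's binder to the hypothesis; its two helpers are imported (`exists_canonicalDensity_le_pow_mul`: pointwise
`dλ₀/dG_N ≤ Λ^{N+1}` for the homogeneous reference `G_N = gibbs σ 1 (2 sup θ₀)`; `lintegral_withDensity_le_of_exp_moment`: the elementary
change-of-measure inequality `∫ t dP ≤ B + log L + 1` from `p ≤ L q`, `∫ e^t dQ ≤ e^B`). References: H. Spohn, *Large Scale Dynamics of
Interacting Particles* (1991), Part I §2.3; C. Kipnis, C. Landim, *Scaling Limits of Interacting Particle Systems* (1999), App. 1 §8.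
-/

noncomputable section

open MeasureTheory Set Filter Topology
open scoped ENNReal

namespace Summit.AtomisticToContinuum.HydrodynamicLimit.Theorems.CollisionActivityTailsPlaqueSplit

open Literature.MathematicalPhysics.KineticTheory Literature.Analysis.FluidPDE
open Summit.AtomisticToContinuum.HydrodynamicLimit.Theorems.CollisionActivityTailsActivityDomination (Flow Cfg window act tdist nearCount)
open Summit.AtomisticToContinuum.HydrodynamicLimit.Theorems.CollisionActivityTailsNearFieldKineticTails (tailFn tailFn_of_lt tailFn_of_le tailFn_nonneg)
open Summit.AtomisticToContinuum.HydrodynamicLimit.Theorems.CollisionActivityTailsEntropyTransfer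
  (exists_canonicalDensity_le_pow_mul lintegral_withDensity_le_of_exp_moment budget_arith)

/-- **STUB 3' of line `plaque-thinning-count-ld` (entropy transfer at time zero, dense-phase guard).** As `stub_entropyTransfer` (p130202):
reference `G_N = gibbs σ 1 θ₁ N Φ`, `θ₁ = 2 sup θ₀`, pointwise `dλ₀/dG_N ≤ Λ^{N+1}`, the elementary change-of-measure inequality with
`t = γ F`, `B = N + 1`, `L = Λ^{N+1}`, `γ = (log Λ + 2)/η`; the guard `y σ³ ≤ 1` is handed to the hypothesis unchanged. -/
theorem stub_entropyTransferDilute : EquilibriumUntaggedActivityLMGF' → UntaggedActivityTails' := by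
  intro hE a₀ θ₀ u₀ ha hθ hu ha0 hθ0
  obtain ⟨θ₁, hθ₁, Λ, hΛ, hdom⟩ := exists_canonicalDensity_le_pow_mul ha hθ hu ha0 hθ0
  obtain ⟨σ₁, hσ₁, hE⟩ := hE 1 θ₁ one_pos hθ₁
  refine ⟨min σ₁ (1 / 2), lt_min hσ₁ (by norm_num), ?_⟩
  intro σ hσ hσlt T ρ θ u _ Φ _ t _ y hy hyσ
  have hσ₁' : σ < σ₁ := hσlt.trans_le (min_le_left _ _)
  have hσ2 : σ ≤ 1 / 2 := (hσlt.trans_le (min_le_right _ _)).le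
  obtain ⟨V₀, hV₀, hE⟩ := hE σ hσ hσ₁' y hy hyσ
  refine ⟨V₀, hV₀, ?_⟩
  intro V hV Θ hΘ K η hη
  set κ : ℝ := Real.log Λ with hκ
  have hκ0 : 0 ≤ κ := Real.log_nonneg hΛ
  have hγ : 0 < (κ + 2) / η := by positivity
  obtain ⟨τ₀, hτ₀, hE⟩ := hE V hV Θ hΘ K ((κ + 2) / η) hγ 1 one_pos
  refine ⟨τ₀, hτ₀, fun τ hτ => ?_⟩
  obtain ⟨N₀, hE⟩ := hE τ hτ
  refine ⟨N₀, fun N hN s hs => ?_⟩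
  obtain ⟨hmeas, hmom⟩ := hE N hN (Φ N) s hs.1
  -- the two laws
  have hac : localGibbsLaw σ a₀ u₀ θ₀ N (Φ N) ≪ gibbs σ 1 θ₁ N (Φ N) :=
    localGibbsLaw_absolutelyContinuous_localGibbsLaw continuous_const continuous_const continuous_const
      (fun _ => one_pos) (fun _ => hθ₁) a₀ u₀ θ₀ hσ2 N (Φ N)
  refine ⟨hmeas.mono_ac hac, ?_⟩
  haveI : IsProbabilityMeasure (localGibbsLaw σ a₀ u₀ θ₀ N (Φ N)) :=
    isProbabilityMeasure_localGibbsLaw ha hθ hu ha0 hθ0 hσ2 N (Φ N)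
  -- densities
  set F : Cfg N → ℝ := fun z => ∑ i : Fin (N + 1), tailFn V (uncAct Θ y K (Φ N) τ s i z) with hF
  set p : Cfg N → ℝ := canonicalDensity (Torus.geometry (Fin 3)) (hsDiameter σ N) (N + 1)
    (localGibbsProfile a₀ u₀ θ₀) with hp
  set q : Cfg N → ℝ := canonicalDensity (Torus.geometry (Fin 3)) (hsDiameter σ N) (N + 1)
    (localGibbsProfile (fun _ => 1) (fun _ => (0 : V3)) (fun _ => θ₁)) with hq
  have hPeq : localGibbsLaw σ a₀ u₀ θ₀ N (Φ N) =
      (volume : Measure (Cfg N)).withDensity fun z => ENNReal.ofReal (p z) := by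
    rw [localGibbsLaw_eq]; rfl
  have hQeq : gibbs σ 1 θ₁ N (Φ N) = (volume : Measure (Cfg N)).withDensity fun z => ENNReal.ofReal (q z) := by
    unfold gibbs; rw [localGibbsLaw_eq]; rfl
  have hpm : Measurable p := measurable_canonicalDensity _ _ (measurable_localGibbsProfile ha hθ hu)
  have hqm : Measurable q :=
    measurable_canonicalDensity _ _ (measurable_localGibbsProfile continuous_const continuous_const continuous_const)
  have hp0 : ∀ z, 0 ≤ p z := fun z =>
    canonicalDensity_nonneg' (fun w => localGibbsProfile_nonneg (fun x => (ha0 x).le) (fun x => (hθ0 x).le) w) _ _ z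
  have hq0 : ∀ z, 0 ≤ q z := fun z =>
    canonicalDensity_nonneg' (fun w => localGibbsProfile_nonneg (fun _ => zero_le_one) (fun _ => hθ₁.le) w) _ _ z
  have hL : (1 : ℝ) ≤ Λ ^ (N + 1) := one_le_pow₀ hΛ
  have hpq : ∀ z, p z ≤ Λ ^ (N + 1) * q z := fun z => hdom σ hσ2 N z
  have hPu : ((volume : Measure (Cfg N)).withDensity fun z => ENNReal.ofReal (p z)) Set.univ ≤ 1 := by
    rw [← hPeq]; exact prob_le_one
  have hB : (0 : ℝ) ≤ 1 * ((N : ℝ) + 1) := by positivity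
  have hmom' : ∫⁻ z, ENNReal.ofReal (Real.exp ((κ + 2) / η * F z))
      ∂((volume : Measure (Cfg N)).withDensity fun z => ENNReal.ofReal (q z)) ≤
      ENNReal.ofReal (Real.exp (1 * ((N : ℝ) + 1))) := by
    rw [← hQeq]; exact hmom
  have hkey := lintegral_withDensity_le_of_exp_moment hpm hqm hp0 hq0 hL hpq hPu
    (fun z => (κ + 2) / η * F z) hB hmom'
  rw [← hPeq, Real.log_pow] at hkey
  -- `(N+1)⁻¹ F = ((N+1) γ)⁻¹ · (γ F)`
  have hsplit : ∀ z, ENNReal.ofReal (((N : ℝ) + 1)⁻¹ * F z) =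
      ENNReal.ofReal ((((N : ℝ) + 1) * ((κ + 2) / η))⁻¹) * ENNReal.ofReal ((κ + 2) / η * F z) := fun z => by
    rw [← ENNReal.ofReal_mul (inv_nonneg.2 (by positivity))]
    congr 1
    field_simp
  show ∫⁻ z, ENNReal.ofReal (((N : ℝ) + 1)⁻¹ * F z) ∂(localGibbsLaw σ a₀ u₀ θ₀ N (Φ N)) ≤ ENNReal.ofReal η
  simp_rw [hsplit]
  rw [lintegral_const_mul' _ _ ENNReal.ofReal_ne_top]
  calc ENNReal.ofReal ((((N : ℝ) + 1) * ((κ + 2) / η))⁻¹) *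
        ∫⁻ z, ENNReal.ofReal ((κ + 2) / η * F z) ∂(localGibbsLaw σ a₀ u₀ θ₀ N (Φ N))
      ≤ ENNReal.ofReal ((((N : ℝ) + 1) * ((κ + 2) / η))⁻¹) *
          ENNReal.ofReal (1 * ((N : ℝ) + 1) + ((N + 1 : ℕ) : ℝ) * κ + 1) := mul_le_mul_right hkey _
    _ = ENNReal.ofReal ((((N : ℝ) + 1) * ((κ + 2) / η))⁻¹ *
          (1 * ((N : ℝ) + 1) + ((N : ℝ) + 1) * κ + 1)) := by
        rw [← ENNReal.ofReal_mul (inv_nonneg.2 (by positivity))]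
        push_cast
        ring_nf
    _ ≤ ENNReal.ofReal η := ENNReal.ofReal_le_ofReal (budget_arith hκ0 hη N)


end Summit.AtomisticToContinuum.HydrodynamicLimit.Theorems.CollisionActivityTailsPlaqueSplit

end
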